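import Summits.NavierStokesRegularity.NavierStokesRegularity.Theorems.LerayQuarterDissipationFiniteDissipationLiouvilleLinks
import Summits.NavierStokesRegularity.NavierStokesRegularity.Theorems.ClockStretchingLawClockCeilingLiouvilleNode
import HarnessLib

/-!
# Route `LerayQuarterDissipation`: its cruxes `FiniteDissipationLiouville` (stmt-22144) and
# `RecurrentDissipativeLiouville` (stmt-22508) sit BELOW the tree's Type-I Liouville node

Theorems file (seat ns-lqd-p1 g2; `--supports` the cruxes; bookkeeping one-liners). Navier–Stokes
regularity is NOT proved by anything here; no summit is.

The tree's kernel-checked "Type-I Liouville node" (file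
`ClockStretchingLawClockCeilingLiouvilleNode.lean` and the `SqueezeCycle…Iff…` files): the items
`TypeIAncientLiouville` (stmt-4050), `SqueezeLiouville` (11608), `ExtremalBiaxialitySubcritical`
(11609), `RecurrentLiouville` (1589), `NoTypeIRateProfile` (1588), `NoSingularTypeIModel` (10569),
`ClockCeiling` (10570) and `NoApexTypeIProfile ∧ ApexLocalisation` (11716 ∧ 11719) are PAIRWISE
EQUIVALENT. By `…Links.finiteDissipationLiouville_of_typeIAncientLiouville` (4050 ⇒ FDL) every one
of them implies FDL, hence RDL (`…Links.finiteDissipationLiouville_iff_recurrentDissipativeLiouville`).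
This file records those edges by name, in particular the route text's "RDL is the meet of
RecurrentLiouville (1589) and FDL (22144)" in its sharp form: `RecurrentLiouville → RDL` outright.

DAG (all arrows kernel-checked): (L) ⇒ node {4050 ⇔ 11608 ⇔ 11609 ⇔ 1589 ⇔ 1588 ⇔ 10569 ⇔ 10570 ⇔
(11716 ∧ 11719)} ⇒ FDL ⇔ RDL ⇒ `TypeIDSSLiouvilleConjecture`; also 0893 ⇒ FDL (`…OfGaldi`).
-/

noncomputable section

-- the summit and its single sub-problem share the name (CONVENTIONS §1), as in every Theorems file
set_option linter.dupNamespace false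

namespace Summit.NavierStokesRegularity.NavierStokesRegularity.Theorems.FiniteDissipationLiouville.Node

open Summit.NavierStokesRegularity.NavierStokesRegularity.Theses

/-- **`RecurrentLiouville` (stmt-1589, routes RecurrentProfiles / SqueezeCycle) ⇒ FDL** (via the node
equivalence 1589 ⇔ 4050 and 4050 ⇒ FDL). -/
theorem finiteDissipationLiouville_of_recurrentLiouville (h : SqueezeCycle.RecurrentLiouville) :
    LerayQuarterDissipation.FiniteDissipationLiouville :=
  Links.finiteDissipationLiouville_of_typeIAncientLiouville
    (typeIAncientLiouville_iff_recurrentLiouville.2 h)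

/-- **`RecurrentLiouville` (stmt-1589) ⇒ RDL (stmt-22508)** — the child crux is implied OUTRIGHT by
RecurrentProfiles' crux (the route text called RDL "the meet of 1589 and 22144"). -/
theorem recurrentDissipativeLiouville_of_recurrentLiouville (h : SqueezeCycle.RecurrentLiouville) :
    LerayQuarterDissipation.RecurrentDissipativeLiouville :=
  Links.finiteDissipationLiouville_iff_recurrentDissipativeLiouville.1
    (finiteDissipationLiouville_of_recurrentLiouville h)

/-- **`SqueezeLiouville` (stmt-11608, SqueezeCycle's target) ⇒ FDL.** -/
theorem finiteDissipationLiouville_of_squeezeLiouville (h : SqueezeCycle.SqueezeLiouville) :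
    LerayQuarterDissipation.FiniteDissipationLiouville :=
  Links.finiteDissipationLiouville_of_typeIAncientLiouville
    (squeezeLiouville_iff_typeIAncientLiouville.1 h)

/-- **`ExtremalBiaxialitySubcritical` (stmt-11609) ⇒ FDL.** -/
theorem finiteDissipationLiouville_of_extremalBiaxialitySubcritical
    (h : SqueezeCycle.ExtremalBiaxialitySubcritical) :
    LerayQuarterDissipation.FiniteDissipationLiouville :=
  Links.finiteDissipationLiouville_of_typeIAncientLiouville
    (extremalBiaxialitySubcritical_iff_typeIAncientLiouville.1 h)

/-- **`NoSingularTypeIModel` (stmt-10569, ClockStretchingLaw's target) ⇒ FDL.** -/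
theorem finiteDissipationLiouville_of_noSingularTypeIModel
    (h : ClockStretchingLaw.NoSingularTypeIModel) :
    LerayQuarterDissipation.FiniteDissipationLiouville :=
  finiteDissipationLiouville_of_squeezeLiouville (squeezeLiouville_iff_noSingularTypeIModel.2 h)

/-- **`ClockCeiling` (stmt-10570, ClockStretchingLaw's crux) ⇒ FDL.** -/
theorem finiteDissipationLiouville_of_clockCeiling (h : ClockStretchingLaw.ClockCeiling) :
    LerayQuarterDissipation.FiniteDissipationLiouville :=
  Links.finiteDissipationLiouville_of_typeIAncientLiouville (clockCeiling_iff_typeIAncientLiouville.1 h)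

/-- **`NoTypeIRateProfile` (stmt-1588, RecurrentProfiles' / DulacContraction's target) ⇒ FDL.** -/
theorem finiteDissipationLiouville_of_noTypeIRateProfile (h : RecurrentProfiles.NoTypeIRateProfile) :
    LerayQuarterDissipation.FiniteDissipationLiouville :=
  Links.finiteDissipationLiouville_of_typeIAncientLiouville
    (typeIAncientLiouville_iff_noTypeIRateProfile.2 h)

/-- **RellichScar's `NoApexTypeIProfile ∧ ApexLocalisation` (stmt-11716 ∧ stmt-11719) ⇒ FDL.** -/
theorem finiteDissipationLiouville_of_rellichScar
    (h : RellichScar.NoApexTypeIProfile ∧ RellichScar.ApexLocalisation) :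
    LerayQuarterDissipation.FiniteDissipationLiouville :=
  Links.finiteDissipationLiouville_of_typeIAncientLiouville (typeIAncientLiouville_iff_rellichScar.2 h)

/-- **Every node statement implies RDL** (through FDL ⇔ RDL); recorded for `ClockCeiling`, the
youngest member of the node. -/
theorem recurrentDissipativeLiouville_of_clockCeiling (h : ClockStretchingLaw.ClockCeiling) :
    LerayQuarterDissipation.RecurrentDissipativeLiouville :=
  Links.finiteDissipationLiouville_iff_recurrentDissipativeLiouville.1
    (finiteDissipationLiouville_of_clockCeiling h)

end Summit.NavierStokesRegularity.NavierStokesRegularity.Theorems.FiniteDissipationLiouville.Node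

end
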